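import Mathlib
import Literature.Computability.AlgebraicComplexity.TableauScaling
import Summits.ValiantsHypothesis.ValiantsHypothesis.Theorems.GeneratorObstructionsGenFlipThesisSliceTransfer

/-!
# Route GeneratorObstructions — crux K2 `PowGenDegreeQP` (stmt-ValiantsHypothesis-11655), line
# `trace-side-regimes`: the antitone enumeration of the matrix letters

Companion of `…PowGenDegreeQPTableauBridge`.  The tableau highest-weight vectors of the tree
(`TableauEval.TabM.tabPoly_mem_highestWeightSpace`) are stated against an antitone enumeration
`x : ℕ → σ` of the letters (`IsAntitoneEnum x N`: `x 0 > x 1 > ⋯` lists `σ`).  For the matrix letters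
`σ = MatIdx n` (lexicographic order, `matIdxEquiv n : Fin (n·n) ≃o MatIdx n`) this file supplies:

* `matIdxRevEnum n dflt` — the `i`-th largest letter (`i < n²`; junk `dflt` beyond) and
  `isAntitoneEnum_matIdxRevEnum`;
* `matIdxTopSeg n c` — the explicit final segment of length `c`, strictly monotone onto an upper set;
* `matIdxRevEnum_eq_of_strictMono_isUpperSet` — **a final segment lists the top letters**: for ANY
  strictly monotone `ι : Fin c → MatIdx n` onto an upper set, `x i = ι (c-1-i)` for `i < c` (final
  segments are unique, `SliceTransfer.strictMono_eq_of_isUpperSet`) — so the canonically placed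
  doubling gadget of `not_powGenDegreeQP_of_canonicalGadgetGIT(_pow)` sits on rows `0, …, 3c-1` of the
  enumeration, as the tableau certificate (blueprint `evidence-11655-leafhand3-g5.md`) requires.

Honest framing: plumbing; no stub, crux or summit is settled here; `VP ≠ VNP` untouched. [folklore]
-/

namespace Summit.ValiantsHypothesis.ValiantsHypothesis.Theorems.GeneratorObstructions.PowGenDegreeQP

open Literature.NumberTheory.DiophantineGeometry Literature.Computability.AlgebraicComplexity
  Literature.Computability.AlgebraicComplexity.TableauEval

-- `Summit.ValiantsHypothesis.ValiantsHypothesis.…` is the tree's mandated single-conjunct layout.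
set_option linter.dupNamespace false

noncomputable section

/-! ## The antitone enumeration of the matrix letters and the canonical final segment -/

section MatLetters

/-- The antitone enumeration of `MatIdx n` (largest letter first): `i ↦` the `i`-th largest letter
for `i < n²` (junk `dflt` beyond). [folklore] -/
def matIdxRevEnum (n : ℕ) (dflt : MatIdx n) : ℕ → MatIdx n :=
  fun i => if h : i < n * n then matIdxEquiv n (Fin.rev ⟨i, h⟩) else dflt

/-- Unfolding `matIdxRevEnum` below `n²`. [folklore] -/
theorem matIdxRevEnum_of_lt (n : ℕ) (dflt : MatIdx n) {i : ℕ} (hi : i < n * n) :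
    matIdxRevEnum n dflt i = matIdxEquiv n (Fin.rev ⟨i, hi⟩) := by
  simp [matIdxRevEnum, hi]

/-- `matIdxRevEnum` is an antitone enumeration of the `n²` matrix letters. [folklore] -/
theorem isAntitoneEnum_matIdxRevEnum (n : ℕ) (dflt : MatIdx n) :
    IsAntitoneEnum (matIdxRevEnum n dflt) (n * n) where
  anti i j hij hj := by
    have hi : i < n * n := lt_trans hij hj
    rw [matIdxRevEnum_of_lt n dflt hj, matIdxRevEnum_of_lt n dflt hi]
    apply (matIdxEquiv n).strictMono
    rw [Fin.lt_def]
    simp only [Fin.val_rev]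
    omega
  surj v := by
    refine ⟨(Fin.rev ((matIdxEquiv n).symm v) : ℕ), (Fin.rev ((matIdxEquiv n).symm v)).isLt, ?_⟩
    rw [matIdxRevEnum_of_lt n dflt (Fin.rev ((matIdxEquiv n).symm v)).isLt]
    have : (⟨((Fin.rev ((matIdxEquiv n).symm v) : Fin (n * n)) : ℕ),
        (Fin.rev ((matIdxEquiv n).symm v)).isLt⟩ : Fin (n * n)) =
        Fin.rev ((matIdxEquiv n).symm v) := Fin.ext rfl
    rw [this, Fin.rev_rev, OrderIso.apply_symm_apply]

/-- The explicit final segment of length `c` of `MatIdx n`: `j ↦` the letter of rank `n² - c + j`.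
[folklore] -/
def matIdxTopSeg (n c : ℕ) (hc : c ≤ n * n) : Fin c → MatIdx n :=
  fun j => matIdxEquiv n ⟨n * n - c + j.val, by have := j.isLt; omega⟩

/-- `matIdxTopSeg` is strictly monotone. [folklore] -/
theorem strictMono_matIdxTopSeg (n c : ℕ) (hc : c ≤ n * n) : StrictMono (matIdxTopSeg n c hc) := by
  intro a b hab
  apply (matIdxEquiv n).strictMono
  rw [Fin.lt_def]
  simp only
  exact Nat.add_lt_add_left hab _

/-- `matIdxTopSeg` maps onto an upper set. [folklore] -/
theorem isUpperSet_range_matIdxTopSeg (n c : ℕ) (hc : c ≤ n * n) :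
    IsUpperSet (Set.range (matIdxTopSeg n c hc)) := by
  rintro v w hvw ⟨a, rfl⟩
  have h1 : (matIdxEquiv n).symm (matIdxTopSeg n c hc a) ≤ (matIdxEquiv n).symm w :=
    (matIdxEquiv n).symm.monotone hvw
  rw [matIdxTopSeg, OrderIso.symm_apply_apply, Fin.le_def] at h1
  simp only at h1
  refine ⟨⟨((matIdxEquiv n).symm w : ℕ) - (n * n - c), by
    have := ((matIdxEquiv n).symm w).isLt; omega⟩, ?_⟩
  rw [matIdxTopSeg]
  have h2 : (⟨n * n - c + (((matIdxEquiv n).symm w : ℕ) - (n * n - c)), by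
      have := ((matIdxEquiv n).symm w).isLt; omega⟩ : Fin (n * n)) = (matIdxEquiv n).symm w :=
    Fin.ext (by simp only; omega)
  rw [h2, OrderIso.apply_symm_apply]

/-- **A final segment lists the top letters of the antitone enumeration**: for a strictly monotone
`ι : Fin c → MatIdx n` onto an upper set and `i < c`, the `i`-th largest matrix letter is
`ι (c - 1 - i)`. [folklore] -/
theorem matIdxRevEnum_eq_of_strictMono_isUpperSet {n c : ℕ} (ι : Fin c → MatIdx n)
    (hι : StrictMono ι) (hup : IsUpperSet (Set.range ι)) (dflt : MatIdx n) {i : ℕ} (hi : i < c) :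
    matIdxRevEnum n dflt i = ι ⟨c - 1 - i, by omega⟩ := by
  have hc : c ≤ n * n := by
    have h := Fintype.card_le_of_injective ι hι.injective
    rwa [Fintype.card_fin, Fintype.card_lex, Fintype.card_prod, Fintype.card_fin] at h
  have heq : ι = matIdxTopSeg n c hc :=
    SliceTransfer.strictMono_eq_of_isUpperSet hι hup (strictMono_matIdxTopSeg n c hc)
      (isUpperSet_range_matIdxTopSeg n c hc)
  rw [heq, matIdxRevEnum_of_lt n dflt (by omega), matIdxTopSeg]
  congr 1
  apply Fin.ext
  simp only [Fin.val_rev]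
  omega

end MatLetters

end

end Summit.ValiantsHypothesis.ValiantsHypothesis.Theorems.GeneratorObstructions.PowGenDegreeQP
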